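import Summits.MatrixMultiplication.MatrixMultiplication.Theorems.LevelOneGL2Designs.Negative.RectangleTranslated

/-!
# Negative lemmas for the crux `LieRankDesigns` (stmt-MatrixMultiplication-7614), part S1:
the big Bruhat cell of `SL_2(𝔽_p)` in coordinates, and the twisted Gauss sums of level-one modes over it

Lead-side (line `Sketch`, seat c2) structural result for the Siegel arena of the card
`siegel-triangle-elliptic-twist` at `k = 1`; no theorem here asserts a Theses statement positively, and
no definition is introduced (the big-cell matrix is written out as `!![l, l b; c l, c l b + l⁻¹]`).
Part S2 (`BigCellOrth`) builds from these sums a signed measure on the big cell orthogonal to `F_1` and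
non-zero at the identity; part S3 (`BigCellLevelOne`) derives the kills: the Cohn–Umans triangle
`(U⁻, U_φ, U⁺) ⊂ SL_2(𝔽_p)` and all its radical thickenings are NOT rank-1-separated (`p ≥ 5`).

* `det_bigCell`, `bigCell_eq_one`, `trace_mul_bigCell` — the matrix `u(c)·diag(l, l⁻¹)·v(b) =
  [[l, l b], [c l, c l b + l⁻¹]]` (`u(c) ∈ U⁻`, `v(b) ∈ U⁺`): coordinates `(l, b, c)`, `l ≠ 0`, on the big
  cell `{g ∈ SL_2(𝔽_p) : g₀₀ ≠ 0}`; `lower_mul_bigCell_mul_upper` (`U⁻ × U⁺` shifts `(b, c)`),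
  `root_eq_bigCell` (every element `[[1 − tφ, t], [−φ²t, 1 + tφ]]` of the root group `U_φ` is a big-cell
  matrix with `l = 1 − tφ`).
* `sum_psi_mul_inv` (`Σ_{l ≠ 0} ψ(t/l) = −1`, `t ≠ 0`), `sum_psi_linear` (`Σ_c ψ(cL + R) = ψ(R)·p·[L = 0]`).
* `twist_mul_psi`, `sum_bc_twist_eq_zero`, `sum_bc_twist_eq` — the `(b, c)`-sums of
  `ψ(−ac − db)·ψ(tr(M·g(l,b,c)))` at fixed `l ≠ 0` for `det M = 0`: ZERO when `M₁₁ = 0` (the twist needs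
  `M₀₁ ≠ 0` and `M₁₀ ≠ 0`, impossible), and `p·ψ((aM₁₀ + dM₀₁)/μ)·ψ((μ − ad/μ)/l)` when `M₁₁ = μ ≠ 0` —
  every level-one mode, seen through the `(a,d)`-character of `U⁻ × U⁺`, is the generalised Kloosterman
  phase of the single frequency `μ − ad/μ` ("Bessel function" of the mode).
-/

set_option linter.dupNamespace false

noncomputable section

namespace Summit.MatrixMultiplication.MatrixMultiplication.Theorems.LieRankDesigns.Negative

open Summit.MatrixMultiplication.MatrixMultiplication.Theses.LevelGradedCohnUmans
open Summit.MatrixMultiplication.MatrixMultiplication.Theorems.LevelOneGL2Designs.Negative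

variable {p : ℕ} [Fact p.Prime]

/-! ## The big cell of `SL_2(𝔽_p)` in the coordinates `(l, b, c)` -/

/-- `det [[l, l b], [c l, c l b + l⁻¹]] = 1` for `l ≠ 0`. -/
theorem det_bigCell {l : ZMod p} (hl : l ≠ 0) (b c : ZMod p) :
    Matrix.det (!![l, l * b; c * l, c * l * b + l⁻¹] : Mat p 2) = 1 := by
  rw [Matrix.det_fin_two_of]
  have h : l * l⁻¹ = 1 := mul_inv_cancel₀ hl
  linear_combination h

/-- A big-cell matrix is the identity only at `(l, b, c) = (1, 0, 0)` (for `l = 0` it is singular). -/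
theorem bigCell_eq_one {l b c : ZMod p} (h : (!![l, l * b; c * l, c * l * b + l⁻¹] : Mat p 2) = 1) :
    l = 1 ∧ b = 0 ∧ c = 0 := by
  have h00 := congrFun (congrFun h 0) 0
  have h01 := congrFun (congrFun h 0) 1
  have h10 := congrFun (congrFun h 1) 0
  simp only [Matrix.of_apply, Matrix.cons_val', Matrix.cons_val_zero, Matrix.cons_val_one,
    Matrix.cons_val_fin_one, Matrix.one_apply_eq,
    Matrix.one_apply_ne (show (0 : Fin 2) ≠ 1 by decide),
    Matrix.one_apply_ne (show (1 : Fin 2) ≠ 0 by decide)] at h00 h01 h10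
  refine ⟨h00, ?_, ?_⟩
  · rw [h00, one_mul] at h01; exact h01
  · rw [h00, mul_one] at h10; exact h10

/-- The identity is the big-cell matrix `(1, 0, 0)`. -/
theorem bigCell_one : (!![(1 : ZMod p), 1 * 0; 0 * 1, 0 * 1 * 0 + 1⁻¹] : Mat p 2) = 1 := by
  ext i j
  fin_cases i <;> fin_cases j <;> simp

/-- The trace against a big-cell matrix, expanded. -/
theorem trace_mul_bigCell (M : Mat p 2) (l b c : ZMod p) :
    Matrix.trace (M * !![l, l * b; c * l, c * l * b + l⁻¹])
      = M 0 0 * l + M 0 1 * (c * l) + M 1 0 * (l * b) + M 1 1 * (c * l * b + l⁻¹) := by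
  simp [Matrix.trace_fin_two, Matrix.mul_apply, Fin.sum_univ_two]
  ring

/-- `U⁻ × U⁺` acts on the big cell by shifting the coordinates:
`u(c₁)·g(l,b,c)·v(b₁) = g(l, b + b₁, c + c₁)`. -/
theorem lower_mul_bigCell_mul_upper (l b c b₁ c₁ : ZMod p) :
    (!![1, 0; c₁, 1] : Mat p 2) * !![l, l * b; c * l, c * l * b + l⁻¹] * !![1, b₁; 0, 1]
      = !![l, l * (b + b₁); (c + c₁) * l, (c + c₁) * l * (b + b₁) + l⁻¹] := by
  ext i j
  fin_cases i <;> fin_cases j <;> simp [Matrix.mul_apply, Fin.sum_univ_two] <;> ring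

/-- Every element `[[1 − tφ, t], [−φ²t, 1 + tφ]]` of the root subgroup `U_φ` (`φ ≠ 0`), other than those with
`tφ = 1`, is a big-cell matrix: with `t = (1 − l)/φ` it is `g(l, t/l, −φ²t/l)` (`l ≠ 0`). -/
theorem root_eq_bigCell {φ l : ZMod p} (hφ : φ ≠ 0) (hl : l ≠ 0) :
    (!![1 - ((1 - l) * φ⁻¹) * φ, (1 - l) * φ⁻¹;
        -(φ * φ * ((1 - l) * φ⁻¹)), 1 + ((1 - l) * φ⁻¹) * φ] : Mat p 2)
      = !![l, l * (((1 - l) * φ⁻¹) * l⁻¹);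
           (-(φ * φ * ((1 - l) * φ⁻¹)) * l⁻¹) * l,
           (-(φ * φ * ((1 - l) * φ⁻¹)) * l⁻¹) * l * (((1 - l) * φ⁻¹) * l⁻¹) + l⁻¹] := by
  ext i j
  fin_cases i <;> fin_cases j <;> simp <;> field_simp <;> ring

/-! ## Two character sums over `𝔽_p` -/

/-- `Σ_{l ≠ 0} ψ(t l⁻¹) = −1` for `t ≠ 0` (written over all `l` with the `l = 0` term set to `0`). -/
theorem sum_psi_mul_inv {t : ZMod p} (ht : t ≠ 0) :
    ∑ l : ZMod p, (if l = 0 then (0 : ℂ) else ZMod.stdAddChar (t * l⁻¹)) = -1 := by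
  classical
  have h1 : ∑ l : ZMod p, (if l = 0 then (0 : ℂ) else ZMod.stdAddChar (t * l⁻¹))
      = ∑ l : ZMod p, (if l = 0 then (0 : ℂ) else ZMod.stdAddChar (t * l)) := by
    refine Fintype.sum_equiv (Equiv.inv (ZMod p)) _ _ fun l => ?_
    simp
  rw [h1]
  have h2 : ∀ l : ZMod p, (if l = 0 then (0 : ℂ) else ZMod.stdAddChar (t * l))
      = ZMod.stdAddChar (l * t) - (if l = 0 then ZMod.stdAddChar (l * t) else 0) := by
    intro l
    by_cases hl : l = 0
    · simp [hl]
    · simp [hl, mul_comm]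
  simp_rw [h2]
  rw [Finset.sum_sub_distrib, Finset.sum_ite_eq' Finset.univ (0 : ZMod p), if_pos (Finset.mem_univ _),
    AddChar.sum_mulShift t (ZMod.isPrimitive_stdAddChar p), if_neg ht]
  simp

/-- The linear Gauss sum: `Σ_c ψ(c L + R) = ψ(R) · p·[L = 0]`. -/
theorem sum_psi_linear (L R : ZMod p) :
    ∑ c : ZMod p, ZMod.stdAddChar (c * L + R)
      = ZMod.stdAddChar R * (if L = 0 then (p : ℂ) else 0) := by
  classical
  simp_rw [AddChar.map_add_eq_mul]
  rw [← Finset.sum_mul, AddChar.sum_mulShift L (ZMod.isPrimitive_stdAddChar p), ZMod.card, mul_comm]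
  split_ifs <;> simp

/-! ## The twisted `(b, c)`-sums of a level-one mode over the big cell -/

/-- The `(a,d)`-twist times a mode, characters combined:
`ψ(−ac − db)·ψ(tr(M g(l,b,c))) = ψ(M₀₀ l + M₁₁/l) · ψ(c (M₀₁ l − a + M₁₁ l b) + (M₁₀ l − d) b)`. -/
theorem twist_mul_psi (a d l b c : ZMod p) (M : Mat p 2) :
    ZMod.stdAddChar (-(a * c) - d * b) *
        ZMod.stdAddChar (Matrix.trace (M * !![l, l * b; c * l, c * l * b + l⁻¹]))
      = ZMod.stdAddChar (M 0 0 * l + M 1 1 * l⁻¹) *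
          ZMod.stdAddChar (c * (M 0 1 * l - a + M 1 1 * l * b) + (M 1 0 * l - d) * b) := by
  rw [trace_mul_bigCell, ← AddChar.map_add_eq_mul, ← AddChar.map_add_eq_mul]
  congr 1
  ring

/-- **Modes with `M₁₁ = 0` are invisible to the twist.**  For `l ≠ 0`, `a, d ≠ 0`, `det M = 0`, `M₁₁ = 0`:
`Σ_b Σ_c ψ(−ac − db) ψ(tr(M g(l,b,c))) = 0` (the sum needs `M₀₁ ≠ 0` AND `M₁₀ ≠ 0`, but their product
is `−det M = 0`). -/
theorem sum_bc_twist_eq_zero {a d l : ZMod p} (ha : a ≠ 0) (hd : d ≠ 0)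
    {M : Mat p 2} (hdet : M.det = 0) (h11 : M 1 1 = 0) :
    ∑ b : ZMod p, ∑ c : ZMod p, ZMod.stdAddChar (-(a * c) - d * b) *
      ZMod.stdAddChar (Matrix.trace (M * !![l, l * b; c * l, c * l * b + l⁻¹])) = 0 := by
  classical
  have key : ∀ b c : ZMod p, ZMod.stdAddChar (-(a * c) - d * b) *
      ZMod.stdAddChar (Matrix.trace (M * !![l, l * b; c * l, c * l * b + l⁻¹]))
        = ZMod.stdAddChar (M 0 0 * l) * ZMod.stdAddChar (c * (M 0 1 * l - a) + (M 1 0 * l - d) * b) := by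
    intro b c
    rw [twist_mul_psi, h11]
    simp only [zero_mul, add_zero]
  have hc : ∀ b : ZMod p, ∑ c : ZMod p, ZMod.stdAddChar (c * (M 0 1 * l - a) + (M 1 0 * l - d) * b)
      = ZMod.stdAddChar ((M 1 0 * l - d) * b) * (if M 0 1 * l - a = 0 then (p : ℂ) else 0) :=
    fun b => sum_psi_linear _ _
  have inner : ∀ b : ZMod p, ∑ c : ZMod p, ZMod.stdAddChar (-(a * c) - d * b) *
      ZMod.stdAddChar (Matrix.trace (M * !![l, l * b; c * l, c * l * b + l⁻¹]))
        = ZMod.stdAddChar (M 0 0 * l) *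
          (ZMod.stdAddChar ((M 1 0 * l - d) * b) * (if M 0 1 * l - a = 0 then (p : ℂ) else 0)) := by
    intro b
    rw [Finset.sum_congr rfl (fun c _ => key b c), ← Finset.mul_sum, hc b]
  rw [Finset.sum_congr rfl (fun b _ => inner b), ← Finset.mul_sum]
  -- det M = M₀₀·0 − M₀₁ M₁₀ = 0
  rw [Matrix.det_fin_two, h11, mul_zero, zero_sub, neg_eq_zero] at hdet
  rcases mul_eq_zero.mp hdet with h01 | h10
  · -- M₀₁ = 0: the condition reads −a = 0, false
    have hne : ¬ (M 0 1 * l - a = 0) := by rw [h01, zero_mul, zero_sub, neg_eq_zero]; exact ha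
    simp [hne]
  · -- M₁₀ = 0: the b-sum of ψ(−d b) vanishes
    have hb : ∑ b : ZMod p, ZMod.stdAddChar ((M 1 0 * l - d) * b) = 0 := by
      rw [h10, zero_mul, zero_sub]
      have h := AddChar.sum_mulShift (-d) (ZMod.isPrimitive_stdAddChar p) (R' := ℂ)
      rw [if_neg (neg_ne_zero.mpr hd)] at h
      simpa [mul_comm] using h
    rw [← Finset.sum_mul, hb]
    simp

/-- **Modes with `M₁₁ = μ ≠ 0` project onto one Kloosterman phase.**  For `l ≠ 0`, `det M = 0`, `M₁₁ = μ ≠ 0`: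
`Σ_b Σ_c ψ(−ac − db) ψ(tr(M g(l,b,c))) = p · ψ((a M₁₀ + d M₀₁)/μ) · ψ((μ − ad/μ)/l)` — the `c`-sum pins `b`
to `b* = (a − M₀₁ l)/(μ l)`, and `det M = 0` cancels the `l`-term of the resulting phase. -/
theorem sum_bc_twist_eq {a d l : ZMod p} (hl : l ≠ 0) {M : Mat p 2} (hdet : M.det = 0) (hμ : M 1 1 ≠ 0) :
    ∑ b : ZMod p, ∑ c : ZMod p, ZMod.stdAddChar (-(a * c) - d * b) *
      ZMod.stdAddChar (Matrix.trace (M * !![l, l * b; c * l, c * l * b + l⁻¹]))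
      = (p : ℂ) * ZMod.stdAddChar ((a * M 1 0 + d * M 0 1) * (M 1 1)⁻¹) *
          ZMod.stdAddChar ((M 1 1 - a * d * (M 1 1)⁻¹) * l⁻¹) := by
  classical
  set μ : ZMod p := M 1 1 with hμdef
  have hc : ∀ b : ZMod p,
      ∑ c : ZMod p, ZMod.stdAddChar (c * (M 0 1 * l - a + μ * l * b) + (M 1 0 * l - d) * b)
        = ZMod.stdAddChar ((M 1 0 * l - d) * b) *
            (if M 0 1 * l - a + μ * l * b = 0 then (p : ℂ) else 0) :=
    fun b => sum_psi_linear _ _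
  -- the condition singles out b* = (a − M₀₁ l)/(μ l)
  set bs : ZMod p := (a - M 0 1 * l) * (μ * l)⁻¹ with hbs
  have hμl : μ * l ≠ 0 := mul_ne_zero hμ hl
  have hcond : ∀ b : ZMod p, (M 0 1 * l - a + μ * l * b = 0) ↔ b = bs := by
    intro b
    rw [hbs, eq_mul_inv_iff_mul_eq₀ hμl]
    constructor
    · intro h; linear_combination h
    · intro h; linear_combination h
  have hite : ∀ b : ZMod p, (if M 0 1 * l - a + μ * l * b = 0 then (p : ℂ) else 0)
      = if b = bs then (p : ℂ) else 0 := by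
    intro b
    by_cases h : b = bs
    · rw [if_pos h, if_pos ((hcond b).2 h)]
    · rw [if_neg h, if_neg (fun h' => h ((hcond b).1 h'))]
  have inner : ∀ b : ZMod p, ∑ c : ZMod p, ZMod.stdAddChar (-(a * c) - d * b) *
      ZMod.stdAddChar (Matrix.trace (M * !![l, l * b; c * l, c * l * b + l⁻¹]))
        = if b = bs then ZMod.stdAddChar (M 0 0 * l + μ * l⁻¹) *
            (ZMod.stdAddChar ((M 1 0 * l - d) * bs) * (p : ℂ)) else 0 := by
    intro b
    have hb : ∀ c : ZMod p, ZMod.stdAddChar (-(a * c) - d * b) *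
        ZMod.stdAddChar (Matrix.trace (M * !![l, l * b; c * l, c * l * b + l⁻¹]))
          = ZMod.stdAddChar (M 0 0 * l + μ * l⁻¹) *
              ZMod.stdAddChar (c * (M 0 1 * l - a + μ * l * b) + (M 1 0 * l - d) * b) :=
      fun c => twist_mul_psi a d l b c M
    rw [Finset.sum_congr rfl (fun c _ => hb c), ← Finset.mul_sum, hc b, hite b]
    by_cases h : b = bs
    · rw [if_pos h, if_pos h, h]
    · rw [if_neg h, if_neg h, mul_zero, mul_zero]
  rw [Finset.sum_congr rfl (fun b _ => inner b), Finset.sum_ite_eq' Finset.univ bs,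
    if_pos (Finset.mem_univ _)]
  -- phase identity (uses det M = 0 in the form M₀₀ μ = M₀₁ M₁₀)
  have hdet' : M 0 0 * μ = M 0 1 * M 1 0 := by
    rw [Matrix.det_fin_two] at hdet
    linear_combination hdet
  have hli : l * l⁻¹ = 1 := mul_inv_cancel₀ hl
  have hmi : μ * μ⁻¹ = 1 := mul_inv_cancel₀ hμ
  have hphase : M 0 0 * l + μ * l⁻¹ + (M 1 0 * l - d) * bs
      = (a * M 1 0 + d * M 0 1) * μ⁻¹ + (μ - a * d * μ⁻¹) * l⁻¹ := by
    rw [hbs, mul_inv]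
    linear_combination (a * M 1 0 * μ⁻¹ + d * M 0 1 * μ⁻¹ - μ⁻¹ * l * M 0 1 * M 1 0) * hli
      + (l * μ⁻¹) * hdet' - (l * M 0 0) * hmi
  calc ZMod.stdAddChar (M 0 0 * l + μ * l⁻¹) * (ZMod.stdAddChar ((M 1 0 * l - d) * bs) * (p : ℂ))
      = (p : ℂ) * (ZMod.stdAddChar (M 0 0 * l + μ * l⁻¹) * ZMod.stdAddChar ((M 1 0 * l - d) * bs)) := by
        ring
    _ = (p : ℂ) * ZMod.stdAddChar ((a * M 1 0 + d * M 0 1) * μ⁻¹ + (μ - a * d * μ⁻¹) * l⁻¹) := by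
        rw [← AddChar.map_add_eq_mul, hphase]
    _ = _ := by rw [AddChar.map_add_eq_mul]; ring

end Summit.MatrixMultiplication.MatrixMultiplication.Theorems.LieRankDesigns.Negative

end
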